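import Literature.NumberTheory.PAdicHodge.FontaineDpst
import Literature.NumberTheory.GaloisRepresentations.CrystallineDeformationRingSmoothProofs
import Literature.NumberTheory.GaloisRepresentations.PadicAlgebraIntegral
import HarnessLib

/-!
# The `∃`-facts on crystalline deformation rings reduce to properties of THE pinned datum

Topic `Literature/NumberTheory/GaloisRepresentations`; companion of the accepted
`CrystallineDeformationRing`, `CrystallineDeformationRingSmooth(Proofs)` (Kisin's theorems as
PREDICATES on a datum `𝔇 : PstWeilDeligneData K p`, and the named facts
`PstWeilDeligneData.nonempty`, `CrystallineDeformationRing.nonempty`,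
`Kisin2007_crystallineDeformationRings`, all three of the shape
`∀ K p alg, ∃ 𝔇 : PstWeilDeligneData K p, 𝔇.algebra = alg ∧ P 𝔇`) and of the accepted
`Literature/NumberTheory/PAdicHodge/FontaineDpst` (human ruling D-0018 L2, 2026-08-16: THE datum
`fontainePst F ℓ hℓ : PstWeilDeligneData F ℓ`, Hilbert's `ε` over Fontaine's characterising
clauses `IsFontaineDatum hℓ` — (F1) canonical `ℚ_ℓ`-structure, (F2) the cyclotomic character is
de Rham of weight `-1`, (F3) `UnramifiedWeightsZero`, (F4) the cyclotomic character is
crystalline — whose existence is the T0 named fact `FontaineDatumExists`).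

## Mathematics, and the point of this file

Kisin, *Potentially semi-stable deformation rings*, JAMS 21 (2008): Cor. (2.7.7) (p. 528) "there
exists a quotient `A^{τ,v}_{cr}` of `A` such that for any finite `E`-algebra `B`, a map of
`E`-algebras `A → B` factors through `A^{τ,v}_{cr}` if and only if `V_B` is potentially crystalline
of type `τ` and `p`-adic Hodge type `v`"; (3.3.3) (p. 533) "`|D^□_{V_𝔽}|` is always
representable by a complete local `𝒪_E`-algebra `R^□_{V_𝔽}`"; Thm. (3.3.8) (p. 535)
"`Spec (R^□_{V_𝔽}[1/p])^{τ,v}_{cr}` is formally smooth and equi-dimensional of dimension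
`d² + dim_E adD_{E,K}/Fil⁰ adD_{E,K}`". These are theorems about Fontaine's GENUINE theory
(`B_cris ⊆ B_dR`, `D_pst`).

The three accepted `∃`-facts let the PROVER choose the datum `𝔇`. That packaging under-states
the cited theorems: the accepted truncated model `unramifiedPstWeilDeligneData K p` (period ring
`K̂_nr = (B_dR)^{I_K}`, trivial filtration; "de Rham" = "crystalline" = unramified, all weights
`0`) has `UnramifiedWeightsZero`, `HasCrystallineDeformationRings` and
`HasHodgeTypeCrystallineDeformationRings` (accepted `unramifiedPstWeilDeligneData_unramifiedWeightsZero`,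
`unramifiedPstWeilDeligneData_hasCrystallineDeformationRings`,
`unramifiedPstWeilDeligneData_hasHodgeTypeCrystallineDeformationRings`), and for it the remaining
conjuncts of `Kisin2007_crystallineDeformationRings` come down to the regularity and dimension
`n²` of `𝒪_L⟦X_ij⟧[1/p]` (Mazur's smooth unramified framed deformation ring) — so a discharge of
any of the three `∃`-facts would certify nothing about crystalline representations of non-zero
Hodge–Tate weight (review of `UnramifiedDatum`, p61421: "any such `_holds` via
`unramifiedPstWeilDeligneData` must be treated as fake progress"). Since the ruling D-0018 L2 the
datum is no longer the prover's to choose: the faithful Lean home of Kisin's theorems is the list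
of accepted predicates evaluated at THE datum `fontainePst F ℓ hℓ` (cf. `FontaineDpst`, "Upgrade
path": the body of `fontainePst` becomes the construction of `B_dR(F)`, `WD ∘ D_pst` when the
definition items D1/D2 land, after which these predicates at `fontainePst` ARE Kisin's theorems).

This file PROVES that the three `∃`-facts are consequences of `FontaineDatumExists` together with
Kisin's predicates at THE datum, so that they can be retired in favour of the pinned forms (or kept
as corollaries): the witness is `fontainePst K p _`, whose `ℚ_p`-algebra structure is the given
one because a local field of characteristic `0` carries at most one `ℚ_p`-algebra structure, which
forces `|p|_K < 1` (accepted `LocalField.algebra_padic_ext`,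
`LocalField.valuation_natCast_lt_one_of_algebra`; Serre, *Local Fields* II §5), and which has
`UnramifiedWeightsZero` by clause (F3). No named fact is introduced here (D-0026): Kisin's three
predicates at THE datum enter as explicit hypotheses `h₁ h₂ h₃` of the reductions; since the
reviewed clause addition of 2026-08-16 they are clauses (F5)–(F7) of `IsFontaineDatum` (accepted
`fontainePst_kisin`), which discharges the hypotheses from `FontaineDatumExists` (last section).

## What this file provides (sorry-free, no new definition, no named fact)

* `PstWeilDeligneData.nonempty_of_fontaineDatumExists` — `PstWeilDeligneData.nonempty` follows
  from `FontaineDatumExists` ALONE.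
* `kisin2007_crystallineDeformationRings_of_fontainePst` — `Kisin2007_crystallineDeformationRings`
  follows from `FontaineDatumExists` and Kisin's three predicates at THE datum
  (`HasCrystallineDeformationRings`, `HasHodgeTypeCrystallineDeformationRings`,
  `CrystallineGenericFibreRegular` of `fontainePst F ℓ hℓ` for all `F`, `ℓ`, `hℓ`); the [BLGGT]
  §1.4 conjunct is derived by the accepted
  `CrystallineGenericFibreRegular.crystallinePointsOnUniqueComponent`.
* `CrystallineDeformationRing.nonempty_of_fontainePst` — `CrystallineDeformationRing.nonempty`
  follows from `FontaineDatumExists` and Kisin's interval-form predicate at THE datum.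
* `fontainePst_crystallinePointsOnUniqueComponent`, `fontainePst_equivalence_onCommonComponent`
  — for THE datum, a regular generic fibre gives "every `ℚ̄_ℓ`-point on a unique component" and
  "'connects' is an equivalence relation" ([BLGGT] §1.4);
  `fontainePst_nonempty_crystallineDeformationRing_one` — non-vacuity of the interval form at THE
  datum (trivial `ρ̄`, `0 ∈ [a, b]`), from (F3).
* AFTER the clause addition (F5)–(F7) to `IsFontaineDatum` (Kisin's theorems, 2026-08-16; accepted
  `fontainePst_kisin`): `kisin2007_crystallineDeformationRings_of_fontaineDatumExists` and
  `CrystallineDeformationRing.nonempty_of_fontaineDatumExists` — the `∃`-facts are corollaries of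
  `FontaineDatumExists` ALONE (their discharge is exactly the T0 debt), and
  `fontainePst_equivalence_onCommonComponent_of_fontaineDatumExists`.

## References

* M. Kisin, *Potentially semi-stable deformation rings*, J. Amer. Math. Soc. 21 (2008), 513–546:
  Introduction, Thm. (2.5.5), Cor. (2.7.7) (p. 528), (3.3.3) (p. 533), Thm. (3.3.8) (p. 535).
  [Kisin2007]
* T. Barnet-Lamb, T. Gee, D. Geraghty, R. Taylor, *Potential automorphy and change of weight*,
  Ann. of Math. 179 (2014), §1.3–1.4 (pp. 12–14 of arXiv:1010.2561). [BarnetlambEtAl2014]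
* J.-M. Fontaine, *Représentations p-adiques semi-stables* (Exp. III), Astérisque 223 (1994),
  §3, §5. [FontaineAsterisque223III]
* J.-P. Serre, *Local Fields* (1979), Ch. II §5 (rigidity of `ℚ_p → K`). [SerreLocalFields1979]
-/

noncomputable section

open Field IsLocalRing ValuativeRel
open Literature.NumberTheory.PAdicHodge

namespace Literature.NumberTheory.GaloisRepresentations

/-! ### Consequences of a regular generic fibre, at THE datum -/

section AtTheDatum

variable {F : Type} [Field F] [ValuativeRel F] [TopologicalSpace F] [IsNonarchimedeanLocalField F]
  [CharZero F] {ℓ : ℕ} [Fact ℓ.Prime]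

/-- **[BLGGT] §1.4 at THE datum**: if the crystalline deformation rings of fixed Hodge type of
`fontainePst F ℓ hℓ` have regular generic fibres (Kisin, Thm. (3.3.8)), every `ℚ̄_ℓ`-point lies on
a unique irreducible component of the geometric generic fibre (accepted
`CrystallineGenericFibreRegular.crystallinePointsOnUniqueComponent`).
[cite: BarnetlambEtAl2014, §1.4] [cite: Kisin2007, Thm. 3.3.8] -/
theorem fontainePst_crystallinePointsOnUniqueComponent (hℓ : valuation F ℓ < 1)
    (h₃ : (fontainePst F ℓ hℓ).CrystallineGenericFibreRegular) :
    (fontainePst F ℓ hℓ).CrystallinePointsOnUniqueComponent :=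
  h₃.crystallinePointsOnUniqueComponent

/-- **"'Connects' is an equivalence relation"** on the `ℚ̄_ℓ`-points of every crystalline
deformation ring of fixed Hodge type of THE datum, given Kisin's regular generic fibre.
[cite: BarnetlambEtAl2014, §1.4] -/
theorem fontainePst_equivalence_onCommonComponent (hℓ : valuation F ℓ < 1)
    (h₃ : (fontainePst F ℓ hℓ).CrystallineGenericFibreRegular)
    (L : IntermediateField ℚ_[ℓ] (PadicAlgCl ℓ)) [FiniteDimensional ℚ_[ℓ] L]
    (hL : letI := (fontainePst F ℓ hℓ).algebra
      ∀ (τ : F →ₐ[ℚ_[ℓ]] PadicAlgCl ℓ) (a : F), τ a ∈ L) {n : ℕ} :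
    letI := intermediateFieldIntegers.algebraPadicAlgCl L
    letI : TopologicalSpace (ResidueField (intermediateFieldIntegers ℓ L)) := ⊥
    ∀ (ρbar : FramedRep (absoluteGaloisGroup F) (ResidueField (intermediateFieldIntegers ℓ L)) n)
      (v : (F →+* PadicAlgCl ℓ) → Multiset ℤ)
      (𝓡 : CrystallineDeformationRing ℓ F (intermediateFieldIntegers ℓ L)
        (ResidueField (intermediateFieldIntegers ℓ L)) ρbar (fontainePst F ℓ hℓ)
        ((fontainePst F ℓ hℓ).HasHodgeType v)),
      Equivalence 𝓡.OnCommonComponent :=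
  (fontainePst_crystallinePointsOnUniqueComponent hℓ h₃).equivalence_onCommonComponent L hL

/-- **Non-vacuity of the interval form at THE datum**: under `FontaineDatumExists` (clause (F3),
`UnramifiedWeightsZero`), if `fontainePst F ℓ hℓ` has Kisin's interval-form crystalline
deformation rings then the ring of the TRIVIAL residual representation with weights in
`[a, b] ∋ 0` exists (accepted `HasCrystallineDeformationRings.nonempty_one`).
[cite: BarnetlambEtAl2014, §1.4] [cite: Kisin2007, Introduction and Cor. 2.7.7] -/
theorem fontainePst_nonempty_crystallineDeformationRing_one (h₀ : FontaineDatumExists)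
    (hℓ : valuation F ℓ < 1) (h₁ : (fontainePst F ℓ hℓ).HasCrystallineDeformationRings)
    (L : IntermediateField ℚ_[ℓ] (PadicAlgCl ℓ)) [FiniteDimensional ℚ_[ℓ] L] (n : ℕ) {a b : ℤ}
    (ha : a ≤ 0) (hb : 0 ≤ b) :
    letI := intermediateFieldIntegers.algebraPadicAlgCl L
    letI : TopologicalSpace (ResidueField (intermediateFieldIntegers ℓ L)) := ⊥
    Nonempty (CrystallineDeformationRing ℓ F (intermediateFieldIntegers ℓ L)
      (ResidueField (intermediateFieldIntegers ℓ L))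
      (1 : FramedRep (absoluteGaloisGroup F) (ResidueField (intermediateFieldIntegers ℓ L)) n)
      (fontainePst F ℓ hℓ) ((fontainePst F ℓ hℓ).IsDeRhamWithWeightsIn a b)) :=
  h₁.nonempty_one (fontainePst_clauses h₀ hℓ).2.1 L n ha hb

end AtTheDatum

/-! ### The accepted `∃`-facts over `PstWeilDeligneData` follow from the pinned forms -/

/-- **`PstWeilDeligneData.nonempty` follows from `FontaineDatumExists`.** For any `ℚ_p`-algebra
structure `alg` on the local field `K` (there is only one, accepted
`LocalField.algebra_padic_ext`, and it forces `|p|_K < 1`, accepted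
`LocalField.valuation_natCast_lt_one_of_algebra`), THE datum `fontainePst K p _` carries `alg`
by clause (F1). [cite: FontaineAsterisque223III, Exp. III §3] [cite: SerreLocalFields1979, Ch. II §5] -/
theorem PstWeilDeligneData.nonempty_of_fontaineDatumExists (h₀ : FontaineDatumExists) :
    PstWeilDeligneData.nonempty := by
  intro K _ _ _ _ p _ _ alg
  have hp : valuation K p < 1 := LocalField.valuation_natCast_lt_one_of_algebra (p := p)
  exact ⟨fontainePst K p hp, (fontainePst_algebra h₀ hp).trans (LocalField.algebra_padic_ext _ _)⟩

/-- **`Kisin2007_crystallineDeformationRings` follows from `FontaineDatumExists` and Kisin's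
theorems at THE datum.** Hypotheses: `h₀ : FontaineDatumExists` (T0) and, for every
characteristic-`0` local field `F` of residue characteristic `ℓ`, Kisin's three predicates for
`fontainePst F ℓ hℓ` — `h₁` interval-form rings (Introduction, Thm. (2.5.5), Cor. (2.7.7),
(3.3.3)), `h₂` rings of every labelled Hodge type ((3.3.3), Cor. (2.7.7); [BLGGT] §1.4), `h₃`
regular equidimensional generic fibre (Thm. (3.3.8)). The witness is THE datum `fontainePst K p _`
(algebra structure by (F1) and rigidity, `UnramifiedWeightsZero` by (F3), the [BLGGT] conjunct by
`CrystallineGenericFibreRegular.crystallinePointsOnUniqueComponent`).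
[cite: Kisin2007, Cor. 2.7.7, (3.3.3) and Thm. 3.3.8] [cite: BarnetlambEtAl2014, §1.4] -/
theorem kisin2007_crystallineDeformationRings_of_fontainePst (h₀ : FontaineDatumExists)
    (h₁ : ∀ (F : Type) [Field F] [ValuativeRel F] [TopologicalSpace F]
      [IsNonarchimedeanLocalField F] [CharZero F] (ℓ : ℕ) [Fact ℓ.Prime]
      (hℓ : valuation F ℓ < 1), (fontainePst F ℓ hℓ).HasCrystallineDeformationRings)
    (h₂ : ∀ (F : Type) [Field F] [ValuativeRel F] [TopologicalSpace F]
      [IsNonarchimedeanLocalField F] [CharZero F] (ℓ : ℕ) [Fact ℓ.Prime]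
      (hℓ : valuation F ℓ < 1), (fontainePst F ℓ hℓ).HasHodgeTypeCrystallineDeformationRings)
    (h₃ : ∀ (F : Type) [Field F] [ValuativeRel F] [TopologicalSpace F]
      [IsNonarchimedeanLocalField F] [CharZero F] (ℓ : ℕ) [Fact ℓ.Prime]
      (hℓ : valuation F ℓ < 1), (fontainePst F ℓ hℓ).CrystallineGenericFibreRegular) :
    Kisin2007_crystallineDeformationRings := by
  intro K _ _ _ _ p _ _ alg
  have hp : valuation K p < 1 := LocalField.valuation_natCast_lt_one_of_algebra (p := p)
  exact ⟨fontainePst K p hp, (fontainePst_algebra h₀ hp).trans (LocalField.algebra_padic_ext _ _),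
    (fontainePst_clauses h₀ hp).2.1, h₁ K p hp, h₂ K p hp, h₃ K p hp,
    (h₃ K p hp).crystallinePointsOnUniqueComponent⟩

/-- **`CrystallineDeformationRing.nonempty` follows from `FontaineDatumExists` and Kisin's
interval-form theorem at THE datum** (`h₁`: `HasCrystallineDeformationRings` of
`fontainePst F ℓ hℓ`; Kisin, Introduction, Thm. (2.5.5), Cor. (2.7.7)); the witness is THE datum,
with `UnramifiedWeightsZero` by (F3). [cite: Kisin2007, Introduction, Thm. 2.5.5 and Cor. 2.7.7] -/
theorem CrystallineDeformationRing.nonempty_of_fontainePst (h₀ : FontaineDatumExists)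
    (h₁ : ∀ (F : Type) [Field F] [ValuativeRel F] [TopologicalSpace F]
      [IsNonarchimedeanLocalField F] [CharZero F] (ℓ : ℕ) [Fact ℓ.Prime]
      (hℓ : valuation F ℓ < 1), (fontainePst F ℓ hℓ).HasCrystallineDeformationRings) :
    CrystallineDeformationRing.nonempty := by
  intro K _ _ _ _ p _ _ alg
  have hp : valuation K p < 1 := LocalField.valuation_natCast_lt_one_of_algebra (p := p)
  exact ⟨fontainePst K p hp, (fontainePst_algebra h₀ hp).trans (LocalField.algebra_padic_ext _ _),
    (fontainePst_clauses h₀ hp).2.1, h₁ K p hp⟩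

/-! ### After the clause addition (F5)–(F7): the `∃`-facts follow from `FontaineDatumExists` alone -/

/-- **`Kisin2007_crystallineDeformationRings` is a corollary of the T0 fact
`FontaineDatumExists`.** Since the clause addition of 2026-08-16 the specification
`IsFontaineDatum` contains Kisin's theorems (F5) `HasCrystallineDeformationRings`,
(F6) `HasHodgeTypeCrystallineDeformationRings`, (F7) `CrystallineGenericFibreRegular`
(accepted `fontainePst_kisin`), so the hypotheses `h₁ h₂ h₃` of
`kisin2007_crystallineDeformationRings_of_fontainePst` are discharged by THE datum: the accepted
`∃`-fact holds as soon as Fontaine's datum (with Kisin's theorems for it) exists.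
[cite: Kisin2007, Cor. 2.7.7, (3.3.3) and Thm. 3.3.8] [cite: BarnetlambEtAl2014, §1.4] -/
theorem kisin2007_crystallineDeformationRings_of_fontaineDatumExists (h₀ : FontaineDatumExists) :
    Kisin2007_crystallineDeformationRings :=
  kisin2007_crystallineDeformationRings_of_fontainePst h₀
    (fun F _ _ _ _ _ ℓ _ hℓ => (fontainePst_kisin (F := F) (ℓ := ℓ) h₀ hℓ).1)
    (fun F _ _ _ _ _ ℓ _ hℓ => (fontainePst_kisin (F := F) (ℓ := ℓ) h₀ hℓ).2.1)
    (fun F _ _ _ _ _ ℓ _ hℓ => (fontainePst_kisin (F := F) (ℓ := ℓ) h₀ hℓ).2.2)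

/-- **`CrystallineDeformationRing.nonempty` is a corollary of `FontaineDatumExists`** (clause
(F5) of `IsFontaineDatum`). [cite: Kisin2007, Introduction, Thm. 2.5.5 and Cor. 2.7.7] -/
theorem CrystallineDeformationRing.nonempty_of_fontaineDatumExists (h₀ : FontaineDatumExists) :
    CrystallineDeformationRing.nonempty :=
  CrystallineDeformationRing.nonempty_of_fontainePst h₀
    (fun F _ _ _ _ _ ℓ _ hℓ => (fontainePst_kisin (F := F) (ℓ := ℓ) h₀ hℓ).1)

/-- For THE datum, "'connects' is an equivalence relation" on the points of every crystalline
deformation ring of fixed Hodge type, under `FontaineDatumExists` alone ([BLGGT] §1.4, via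
(F7)). [cite: BarnetlambEtAl2014, §1.4] -/
theorem fontainePst_equivalence_onCommonComponent_of_fontaineDatumExists
    (h₀ : FontaineDatumExists)
    {F : Type} [Field F] [ValuativeRel F] [TopologicalSpace F] [IsNonarchimedeanLocalField F]
    [CharZero F] {ℓ : ℕ} [Fact ℓ.Prime] (hℓ : valuation F ℓ < 1)
    (L : IntermediateField ℚ_[ℓ] (PadicAlgCl ℓ)) [FiniteDimensional ℚ_[ℓ] L]
    (hL : letI := (fontainePst F ℓ hℓ).algebra
      ∀ (τ : F →ₐ[ℚ_[ℓ]] PadicAlgCl ℓ) (a : F), τ a ∈ L) {n : ℕ} :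
    letI := intermediateFieldIntegers.algebraPadicAlgCl L
    letI : TopologicalSpace (ResidueField (intermediateFieldIntegers ℓ L)) := ⊥
    ∀ (ρbar : FramedRep (absoluteGaloisGroup F) (ResidueField (intermediateFieldIntegers ℓ L)) n)
      (v : (F →+* PadicAlgCl ℓ) → Multiset ℤ)
      (𝓡 : CrystallineDeformationRing ℓ F (intermediateFieldIntegers ℓ L)
        (ResidueField (intermediateFieldIntegers ℓ L)) ρbar (fontainePst F ℓ hℓ)
        ((fontainePst F ℓ hℓ).HasHodgeType v)),
      Equivalence 𝓡.OnCommonComponent :=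
  fontainePst_equivalence_onCommonComponent hℓ (fontainePst_kisin h₀ hℓ).2.2 L hL

end Literature.NumberTheory.GaloisRepresentations

end
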